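import Summits.BirchSwinnertonDyer.BirchSwinnertonDyer.Theorems.PrintCFramBottomClassIndexLawFiveLeLevelDictionaryStrictSelmer
import HarnessLib

/-!
# Route `PrintCFram`, crux C2 `BottomClassIndexLawFiveLe` (stmt-BirchSwinnertonDyer-20372), line
# `eisenstein-resource-bdp-line` (registry v18/v19; the LEVEL DICTIONARY (α′)): **`Ш(W/ℚ)[p] = 0` ON THE KRIZ–LI LOCUS, BY DESCENT
# ALONE** — a member of the CM-ramified class with UNIT class factor and a rational point not `p`-divisible in `W(ℚ)` has no `p`-torsion
# in its Tate–Shafarevich group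
# (cell `bsd-print-cfram`, width seat `bsd-line-cfram-p1-w6` g3; helper `--supports` 20372; 0 defs, 0 facts, 0 sorry)

HONEST FRAMING. Nothing about BSD is proved here and no stub of the line is closed; BSD is not proved by any of this. Companion of
`…LevelDictionaryStrictSelmer` (`natCard_selmerGroup_le_of_unit_classFactor`: `#Sel_p(W/ℚ) ≤ p` on the locus). READING for the line:
on the Kriz–Li locus the algebraic `p`-part is rigid — `n = 0` (file 4), `Sel_p(W/ℚ) = 𝔽_p·δ(P)`, `Ш(W/ℚ)[p] = 0` — so Kriz–Li's
Thm 1.20 serves only the analytic statement `ord_p Ш_an(W) = 0` there; and B1's members (irregular class factor) are the only ones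
where `Ш[p]` or the level can be non-trivial (LEAD g10 report §2(d)).

* **`sha_torsion_eq_zero_of_unit_classFactor`** — `W/ℚ` globally minimal with CM, `p ≥ 5` CM-ramified, odd Kriz–Li datum `(f, ψ, ω)`
  with `hss`, `¬ ‖B_{1,ψ⁻¹}‖_p ≤ p⁻¹`, `P ∈ W(ℚ)` with `∀ R, p • R ≠ P` ⊢ every `s ∈ Ш(W/ℚ)` with `p • s = 0` is `0`
  (`Sel_p` has `≤ p` elements and contains the non-zero Kummer class `δ(P)` of order `p`, so `Sel_p = ℤ·δ(P)`; `Sel_p ↠ Ш[p]`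
  (tree `exists_mem_selmerGroupPInfty_primaryH1ToH1_eq`, `exists_mem_selmerGroup_torsionToPrimaryH1_eq`) and `δ(P) ↦ 0`).

THEOREMS ONLY; no definition, no named fact, no `sorry`. No summit statement is proved by this seat. References: [SilvermanAEC2009]
Thm. X.4.2, VIII.§2; [BhargavaSkinner2014] proof of Lemma 16; the LEAD g10 report §2(d) and the w6 g3 crux notes.
-/

set_option autoImplicit false
-- `…BirchSwinnertonDyer.BirchSwinnertonDyer.Theorems…` is the problem's mandated namespace (D-0017).
set_option linter.dupNamespace false

noncomputable section

open scoped Classical Pointwise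

namespace Summit.BirchSwinnertonDyer.BirchSwinnertonDyer.Theorems.PrintCFram.LevelDictionaryAlpha

open NumberField IsDedekindDomain Field WeierstrassCurve DirichletCharacter
open Literature.NumberTheory.EllipticCurves Literature.NumberTheory.GaloisRepresentations
  Literature.NumberTheory.EllipticCurves.Rank1Residual Literature.NumberTheory.EllipticCurves.KrizLi2019
  Literature.NumberTheory.EllipticCurves.GreenbergSelmer
open Summit.BirchSwinnertonDyer.Rank1Residual

/-! ## §3 `Ш(W/ℚ)[p] = 0` on the Kriz–Li locus for members with a non-`p`-divisible rational point -/

section Sha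

variable (W : WeierstrassCurve ℚ) [W.IsElliptic] [W.IsGloballyMinimal] (p : ℕ) [hp : Fact p.Prime]

/-- **`Ш(W/ℚ)[p] = 0` ON THE KRIZ–LI LOCUS, BY DESCENT ALONE.** Let `W/ℚ` be globally minimal with CM, `p ≥ 5` CM-ramified, `(f, ψ, ω)`
an odd Kriz–Li datum with `hss` and UNIT class factor, and let `P ∈ W(ℚ)` be NOT `p`-divisible in `W(ℚ)` (e.g. the generator modulo
torsion of a rank-one member). Then every `s ∈ Ш(W/ℚ)` with `p • s = 0` is `0`. Proof: `Sel_p(W/ℚ)` has at most `p` elements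
(`natCard_selmerGroup_le_of_unit_classFactor`) and contains the non-zero Kummer class `δ(P)` (`kummerMapTorsion_ker`), so
`Sel_p = 𝔽_p·δ(P)`; and `Sel_p ↠ Ш[p]` (tree: `exists_mem_selmerGroupPInfty_primaryH1ToH1_eq`,
`exists_mem_selmerGroup_torsionToPrimaryH1_eq`) kills `δ(P)` (`torsionH1ToH1_kummerMapTorsion`). No `L`-value, no Kriz–Li theorem,
no Mazur–Wiles theorem: on the locus the ALGEBRAIC `p`-part of `Ш` is trivial, and Kriz–Li's Thm 1.20 serves only `ord_p Ш_an = 0`.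
[cite: SilvermanAEC2009, Thm. X.4.2 and VIII.§2] [cite: BhargavaSkinner2014, proof of Lemma 16] -/
theorem sha_torsion_eq_zero_of_unit_classFactor (hCM : W.HasCM) (hram : CMRamified W p) (h5 : 5 ≤ p)
    {f : ℕ} [NeZero f] (ψ : DirichletCharacter ℚ_[p] f) (ω : DirichletCharacter ℚ_[p] p)
    (hψ : ψ.Odd) (hω : IsTeichmullerCharacter ω)
    (hss : ∀ ℓ : ℕ, ℓ.Prime → ¬ (ℓ ∣ p * W.conductorNorm ℤ) →
      ‖((W.LFunction ℓ : ℤ) : ℚ_[p]) - (ψ (ℓ : ZMod f) + ψ⁻¹ (ℓ : ZMod f) * ω (ℓ : ZMod p))‖ < 1)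
    (hcls : ¬ ‖bernoulliOnePrim ψ⁻¹‖ ≤ (p : ℝ)⁻¹)
    (P : W.toAffine.Point) (hP : ∀ R : W.toAffine.Point, (p : ℤ) • R ≠ P)
    {s : W.galH1} (hs : s ∈ W.sha) (hps : p • s = 0) : s = 0 := by
  have hpr : p.Prime := hp.out
  have hp0 : (p : ℤ) ≠ 0 := by exact_mod_cast hpr.ne_zero
  have hdiv : W.zsmul_geomPoints_surjective := W.zsmul_geomPoints_surjective_holds
  -- `s` lifts to a `p`-Selmer class `y`
  obtain ⟨x, hx, hpx, hxs⟩ := exists_mem_selmerGroupPInfty_primaryH1ToH1_eq W p hdiv hs hps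
  obtain ⟨y, hy, rfl⟩ := exists_mem_selmerGroup_torsionToPrimaryH1_eq W p hdiv hx hpx
  rw [primaryH1ToH1_torsionToPrimaryH1] at hxs
  -- the Kummer class of `P`: a non-zero `p`-Selmer class dying in `H¹(ℚ, W)`
  obtain ⟨Qt, hQt⟩ := (W.baseChange (AlgebraicClosure ℚ)).zsmul_surjective_of_isAlgClosed hp0 (toGeomPoints W P)
  have hQt : (p : ℤ) • Qt = toGeomPoints W P := hQt
  have hQfix : (p : ℤ) • Qt ∈ MulAction.fixedPoints (absoluteGaloisGroup ℚ) (geomPoints W) := by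
    rw [hQt]; exact toGeomPoints_mem_fixedPoints W P
  set κ := kummerClassTorsion W (p : ℤ) Qt hQfix with hκ
  have hκsel : κ ∈ selmerGroup W (p : ℤ) :=
    (mem_selmerGroup_iff _ _ _).mpr ⟨fun _ ↦ kummerClassTorsion_mem_selmerLocalKerOfEmb W (p : ℤ) (closureEmb (K := ℚ) _) Qt hQfix,
      fun _ ↦ kummerClassTorsion_mem_selmerLocalKerOfEmb W (p : ℤ) (closureEmb (K := ℚ) _) Qt hQfix⟩
  -- (the generic Kummer lemmas carry the classical `DecidableEq ℚ` on `W(ℚ)`; `convert` bridges the instance)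
  have hP' := fun R : W.toAffine.Point ↦ hP R
  have hκ0 : κ ≠ 0 :=
    LevelDictionary.kummerClassTorsion_ne_zero_of_forall_zsmul_ne W Qt hQfix P hQt (fun R ↦ by convert hP' R)
  have hκsha : torsionH1ToH1 W (p : ℤ) κ = 0 := torsionH1ToH1_kummerClassTorsion W (p : ℤ) Qt hQfix
  -- `Sel_p = ℤ·κ` (at most `p` elements, `κ` of order `p`)
  haveI hfin : Finite (selmerGroup W (p : ℤ)) := W.finite_selmerGroup_holds hp0
  have hle := natCard_selmerGroup_le_of_unit_classFactor W p hCM hram h5 ψ ω hψ hω hss hcls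
  set κ' : selmerGroup W (p : ℤ) := ⟨κ, hκsel⟩ with hκ'
  have hκ'0 : κ' ≠ 0 := fun h ↦ hκ0 (congrArg Subtype.val h)
  have hpκ' : p • κ' = 0 := Subtype.ext (by
    rw [AddSubmonoidClass.coe_nsmul, ZeroMemClass.coe_zero]
    exact nsmul_galH1Torsion_natCast_eq_zero W p κ)
  have hord : addOrderOf κ' = p := addOrderOf_eq_prime hpκ' hκ'0
  have hcard : Nat.card (selmerGroup W (p : ℤ)) = p := by
    refine le_antisymm hle ?_
    have h1 : addOrderOf κ' ≤ Nat.card (selmerGroup W (p : ℤ)) := addOrderOf_le_card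
    rwa [hord] at h1
  have htop : AddSubgroup.zmultiples κ' = ⊤ :=
    HerbrandLineRestriction.zmultiples_eq_top_of_card_prime (p := p) hcard hκ'0
  have hy' : (⟨y, hy⟩ : selmerGroup W (p : ℤ)) ∈ AddSubgroup.zmultiples κ' := by rw [htop]; exact AddSubgroup.mem_top _
  obtain ⟨k, hk⟩ := AddSubgroup.mem_zmultiples_iff.1 hy'
  have hyk : y = k • κ := by
    have h := congrArg Subtype.val hk
    simpa only [hκ', AddSubgroupClass.coe_zsmul] using h.symm
  rw [← hxs, hyk, map_zsmul, hκsha, zsmul_zero]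

/-- **(append) «Ш(W/ℚ)[p] ≠ 0 ⟹ CLASS FACTOR NON-UNIT» — the input of LEAD g11's «B1 ⟹ B1-sha» (STATUS 22:37:40Z INTEGRATION TARGET),
contrapositive of `sha_torsion_eq_zero_of_unit_classFactor`.** On the class, for an odd Kriz–Li datum `(f, ψ, ω)` with `hss` and a rational
point `P` with `∀ R, p • R ≠ P`: a NON-ZERO `s ∈ Ш(W/ℚ)` with `p • s = 0` forces `‖B_{1,ψ⁻¹}‖_p ≤ p⁻¹` (B1's premise).
[cite: SilvermanAEC2009, Thm. X.4.2 and VIII.§2] [cite: KrizLi2019, §1.5 (p. 7)] -/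
theorem norm_bernoulliOnePrim_le_of_sha_ne_zero (hCM : W.HasCM) (hram : CMRamified W p) (h5 : 5 ≤ p)
    {f : ℕ} [NeZero f] (ψ : DirichletCharacter ℚ_[p] f) (ω : DirichletCharacter ℚ_[p] p)
    (hψ : ψ.Odd) (hω : IsTeichmullerCharacter ω)
    (hss : ∀ ℓ : ℕ, ℓ.Prime → ¬ (ℓ ∣ p * W.conductorNorm ℤ) →
      ‖((W.LFunction ℓ : ℤ) : ℚ_[p]) - (ψ (ℓ : ZMod f) + ψ⁻¹ (ℓ : ZMod f) * ω (ℓ : ZMod p))‖ < 1)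
    (P : W.toAffine.Point) (hP : ∀ R : W.toAffine.Point, (p : ℤ) • R ≠ P)
    (hsha : ∃ s ∈ W.sha, s ≠ 0 ∧ p • s = 0) :
    ‖bernoulliOnePrim ψ⁻¹‖ ≤ (p : ℝ)⁻¹ := by
  by_contra hcls
  obtain ⟨s, hs, hs0, hps⟩ := hsha
  exact hs0 (sha_torsion_eq_zero_of_unit_classFactor W p hCM hram h5 ψ ω hψ hω hss hcls P hP hs hps)

/-- **(append) The same in the crux's generator binders** (`P` non-torsion, generating `W(ℚ)` modulo torsion — the binders of
`X12.O11.RamifiedCMBottomClassIndexLawAtZp`; `∀ R, p • R ≠ P` then holds by `forall_zsmul_ne_of_generator`): a non-zero `p`-torsion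
class in `Ш(W/ℚ)` forces the class factor to be a non-unit. With file 4's `norm_bernoulliOnePrim_le_of_one_le_level` this is the
«B1 ⟹ B1-level ∧ B1-sha» direction of LEAD g11's reading of B1 in the crux's own binders: B1's premise holds on every rank-one member
with an invisible generator (`n ≥ 1`) OR non-trivial `Ш[p]`. [cite: SilvermanAEC2009, Thm. X.4.2 and VIII.§2] [cite: KrizLi2019, §1.5 (p. 7)] -/
theorem norm_bernoulliOnePrim_le_of_sha_ne_zero_of_generator (hCM : W.HasCM) (hram : CMRamified W p) (h5 : 5 ≤ p)
    {f : ℕ} [NeZero f] (ψ : DirichletCharacter ℚ_[p] f) (ω : DirichletCharacter ℚ_[p] p)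
    (hψ : ψ.Odd) (hω : IsTeichmullerCharacter ω)
    (hss : ∀ ℓ : ℕ, ℓ.Prime → ¬ (ℓ ∣ p * W.conductorNorm ℤ) →
      ‖((W.LFunction ℓ : ℤ) : ℚ_[p]) - (ψ (ℓ : ZMod f) + ψ⁻¹ (ℓ : ZMod f) * ω (ℓ : ZMod p))‖ < 1)
    (P : W.toAffine.Point) (hPtor : ¬ IsOfFinAddOrder P)
    (hgen : ∀ R : W.toAffine.Point, ∃ (k : ℤ) (T : W.toAffine.Point), IsOfFinAddOrder T ∧ R = k • P + T)
    (hsha : ∃ s ∈ W.sha, s ≠ 0 ∧ p • s = 0) :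
    ‖bernoulliOnePrim ψ⁻¹‖ ≤ (p : ℝ)⁻¹ :=
  norm_bernoulliOnePrim_le_of_sha_ne_zero W p hCM hram h5 ψ ω hψ hω hss P (forall_zsmul_ne_of_generator p W P hPtor hgen) hsha

end Sha

end Summit.BirchSwinnertonDyer.BirchSwinnertonDyer.Theorems.PrintCFram.LevelDictionaryAlpha

end
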